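import Literature.NumberTheory.NumberFields.EquivariantIwasawaLemmaRamificationSplit
import Literature.NumberTheory.EllipticCurves.FineSelmerIsotypicClassGroupCriterion
import HarnessLib

/-!
# Deo–Ray–Sujatha 2023 Thm. 3.9 (b) with (c2) AS PRINTED (`Hom_G(H′_L, E[p]) = 0`) — DISCHARGED
# (`thm39_fineSelmerDual_moduleFinite_of_homTrivial_divisionField_holds`)

Topic `NumberTheory/EllipticCurves` (grouping namespace `DeoRaySujatha2023`).  `Proofs` file (theorems
only: no definition, no named fact, no `sorry`), written by the literature seat `bsd-potss-conjA-anchor`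
g17 (cell `bsd-potss`; serves the asides stmt-BirchSwinnertonDyer-19386 / 19413).  It proves the named
Literature fact `DeoRaySujatha2023.thm39_fineSelmerDual_moduleFinite_of_homTrivial_divisionField`
(`FineSelmerClassGroupCriterion.lean`), whose hypothesis (c2) is the PRINTED one: every `G`-equivariant
`Cl(𝓞_{ℚ(E[p])}) → E[p]` killing the classes of the primes above `S = {p} ∪ {bad}` is zero.  The `_holds`
theorem cannot be appended to the fact's own file (that file lies in the import cone of the proof), so it
lives here, as for `FineSelmerClassGroupCriterionClassNumberProofs.lean`.

* `homTrivial_divisionField_cyclotomicTower_of_splitAt` — door L6 for an elliptic curve with the base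
  hypothesis on the `S`-split class group: (c1) `p ∤ #Gal(ℚ(E[p])/ℚ)`, (c2) every additive
  `Γ_ℚ`-equivariant `Cl(𝓞_{ℚ(E[p])}) → E[p]` killing the classes of the primes above a set `Sk` of places of
  `ℚ` is zero, (c3*) `E[p]^{D_v} = 0` for `v = p` and the places in `Sk` ⟹ for every `n`, every additive
  `Γ_ℚ`-equivariant `Cl(𝓞_{ℚ(E[p])ℚ_{n+1}}) → E[p]` is zero (the `S`-version of the equivariant Iwasawa
  lemma, files VIII–XII of the `EquivariantIwasawaLemma` series, with `p` totally ramified in `ℚ_∞`).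
* `thm39_fineSelmerDual_moduleFinite_of_homTrivial_divisionField_holds` — the fact, by the previous
  theorem and the `H²`-free isotypic Coates–Sujatha argument at the layers `≥ 1`
  (`CoatesSujatha2005.conjA_of_homTrivial_cyclotomicTower_succ`).  PROOF ROAD (not the printed one —
  Deo–Ray–Sujatha go through Poitou–Tate and `H²(ℚ_S/L_∞, E[p]) = 0`): (c2) printed + (c1) + (c3) at `S`
  ⟹ (equivariant Artin reciprocity with `S`-split base, the Frobenius classes of the `S`-primes being
  killed by (c3) through the decomposition invariance of the character) `Hom_Γ(Cl(ℚ(E[p])ℚ_1), E[p]) = 0`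
  ⟹ (Washington §13.3 made isotypic, along the tower) the same at every layer `≥ 1` ⟹ (invariant
  fine-Selmer shadow, equivariant unramified descent «one layer up») `Sel₀(ℚ_∞, E[p])` finite ⟹ (A) by
  Lim–Sujatha.  Hypotheses used: `p ≠ 2`, (c1), (c2) printed, (c3) at `p` and at the bad places, `κ`
  cyclotomic; the irreducibility of `E[p]` is not needed.

## References

* S. V. Deo, A. Ray, R. Sujatha, *On the μ equals zero conjecture for fine Selmer groups in Iwasawa
  theory*, Pure Appl. Math. Q. 19 (2023), §3 Thm. 3.8, Thm. 3.9 (b), definition of `H′_L`; §5 Lemma 5.1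
  (arXiv:2202.09937 pp. 9–10, 17). [DeoRaySujatha2023]
* J. Coates, R. Sujatha, Math. Ann. 331 (2005), §3 Thm. 3.4, Lemma 3.8. [CoatesSujatha2005]
* L. C. Washington, *Introduction to Cyclotomic Fields*, 2nd ed. (1997), §13.1, §13.3, Thm. 10.4.
  [Washington1997]
* J. Neukirch, *Algebraic Number Theory* (1999), Ch. I §9, Ch. IV §6, Ch. VI (6.9), (7.1). [NeukirchANT1999]
-/

noncomputable section

open scoped Classical Pointwise nonZeroDivisors
open NumberField Field IntermediateField IsDedekindDomain WeierstrassCurve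
open Literature.NumberTheory.GaloisRepresentations Literature.NumberTheory.NumberFields
open Literature.NumberTheory.EllipticCurves

namespace Literature.NumberTheory.EllipticCurves.DeoRaySujatha2023

/-- `p ∤ #Gal(L/k) ⟹ p ∤ [L : k]`. [folklore] -/
private theorem not_dvd_finrank_of_not_dvd_card' {k : Type} [Field k]
    (L : IntermediateField k (AlgebraicClosure k)) [FiniteDimensional k L] [IsGalois k L] {p : ℕ}
    (h : ¬ p ∣ Nat.card (L ≃ₐ[k] L)) : ¬ p ∣ Module.finrank k L := by
  rwa [← IsGalois.card_aut_eq_finrank k L]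

/-- A finite subextension of `k̄/k`, `k` a number field, is a number field. [folklore] -/
private theorem numberField_of_finiteDimensional' {k : Type} [Field k] [NumberField k]
    (E : IntermediateField k (AlgebraicClosure k)) [FiniteDimensional k E] : NumberField E :=
  NumberField.of_module_finite k E

/-- The only place of `ℚ` containing the prime `q`. [folklore] -/
private theorem heightOneSpectrum_rat_eq_of_natCast_mem' {q : ℕ} (hq : q.Prime)
    (v v' : HeightOneSpectrum (𝓞 ℚ))
    (hv : ((q : ℕ) : 𝓞 ℚ) ∈ v.asIdeal) (hv' : ((q : ℕ) : 𝓞 ℚ) ∈ v'.asIdeal) : v = v' := by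
  have key : ∀ w : HeightOneSpectrum (𝓞 ℚ), ((q : ℕ) : 𝓞 ℚ) ∈ w.asIdeal →
      Rat.HeightOneSpectrum.primesEquiv w = ⟨q, hq⟩ := by
    intro w hw
    apply Subtype.ext
    change Rat.HeightOneSpectrum.natGenerator w = q
    have h1 : Rat.HeightOneSpectrum.natGenerator w ∣ q := by
      rw [Rat.HeightOneSpectrum.natGenerator_dvd_iff,
        ← map_natCast (Rat.IsIntegralClosure.intEquiv (𝓞 ℚ)) q]
      exact Ideal.mem_map_of_mem _ hw
    exact (Nat.prime_dvd_prime_iff_eq (Rat.HeightOneSpectrum.prime_natGenerator w) hq).mp h1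
  exact Rat.HeightOneSpectrum.primesEquiv.injective ((key v hv).trans (key v' hv').symm)

/-- `E[p]` is killed by `p`. [folklore] -/
private theorem geomTorsion_nsmul_eq_zero' (W : WeierstrassCurve ℚ) [W.IsElliptic] {p : ℕ}
    (v : geomTorsion W (p : ℤ)) : p • v = 0 := by
  apply Subtype.ext
  have hv : ((v : geomTorsion W (p : ℤ)) : geomPoints W) ∈
      AddSubgroup.torsionBy (geomPoints W) (p : ℤ) := v.2
  rw [AddSubgroup.torsionBy, Submodule.mem_toAddSubgroup, Submodule.mem_torsionBy_iff] at hv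
  rw [AddSubgroupClass.coe_nsmul, ZeroMemClass.coe_zero, ← natCast_zsmul]
  exact hv

set_option maxHeartbeats 1600000 in
set_option synthInstance.maxHeartbeats 200000 in
/-- **Door L6 with `S`-split base, (c3*) above `Sk` from decomposition groups** (general number field
`k`).  As `EquivariantIwasawaLemma.equivariantHom_classGroup_eq_zero_layer_compositum_tower_of_
totallyRamified_of_splitAt` (file XII), with its stabiliser-form hypothesis at the primes of `L₀K₁` above
`Sk` discharged from: every `u ∈ Sk` contains a natural number `q` such that `V^{D_v} = 0` for every place
`v ∋ q` of `k` (`EquivariantIwasawaLemma.eq_zero_of_forall_stabilizer_smul_of_decomp`).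
[cite: Washington1997, §13.1 Prop. 13.2, §13.3 Lemmas 13.14–13.15 and Thm. 10.4 (proof)]
[cite: NeukirchANT1999, Ch. I §9 (9.1) and Ch. II §9 (9.6)]
[cite: DeoRaySujatha2023, §3 Thm. 3.8 (c2), (c3) (arXiv:2202.09937 p. 9)] -/
theorem equivariantHom_classGroup_eq_zero_layer_compositum_tower_of_splitAt_of_decomp
    {k : Type} [Field k] [NumberField k] {p : ℕ} [Fact p.Prime] (hp2 : p ≠ 2) (κ : ZpExtension k p)
    (L₀ : IntermediateField k (AlgebraicClosure k)) [FiniteDimensional k L₀] [IsGalois k L₀]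
    [NumberField L₀] (hL₀ : ¬ p ∣ Module.finrank k L₀)
    [∀ n, FiniteDimensional k (κ.layer n)] [∀ n, IsGalois k (κ.layer n)]
    [∀ n, NumberField (L₀ ⊔ κ.layer n : IntermediateField k (AlgebraicClosure k))]
    (hram : ∃ 𝔓' : Ideal (absIntegers (𝓞 k) k), 𝔓'.IsMaximal ∧
      𝔓'.inertia (absoluteGaloisGroup k) ⊔ κ.kerSubgroup = ⊤)
    {V : Type*} [AddCommGroup V] [DistribMulAction (absoluteGaloisGroup k) V]
    (hpV : ∀ v : V, p • v = 0)
    (hV : ∀ τ : absoluteGaloisGroup k, absRestrictNormalHom L₀ τ = 1 → ∀ v : V, τ • v = v)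
    (Sk : HeightOneSpectrum (𝓞 k) → Prop)
    (hSk : ∀ u : HeightOneSpectrum (𝓞 k), Sk u → ∃ q : ℕ, ((q : ℕ) : 𝓞 k) ∈ u.asIdeal ∧
      ∀ v : HeightOneSpectrum (𝓞 k), ((q : ℕ) : 𝓞 k) ∈ v.asIdeal →
        ∀ w : V, (∀ d ∈ GreenbergSelmer.decomp v, d • w = w) → w = 0)
    (h0 : ∀ μ : Additive (ClassGroup (𝓞 L₀)) →+ V,
      (∀ (τ : absoluteGaloisGroup k) (c : ClassGroup (𝓞 L₀)),
        μ (Additive.ofMul (ClassGroup.mulEquiv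
          (AmbiguousClass.intAut (absRestrictNormalHom L₀ τ)) c)) = τ • μ (Additive.ofMul c)) →
      (∀ (v : HeightOneSpectrum (𝓞 L₀)) (u : HeightOneSpectrum (𝓞 k)), Sk u →
        v.asIdeal.under (𝓞 k) = u.asIdeal →
        μ (Additive.ofMul (ClassGroup.mk0 ⟨v.asIdeal, mem_nonZeroDivisors_of_ne_zero v.ne_bot⟩)) = 0) →
      μ = 0)
    (hD : ∀ v : HeightOneSpectrum (𝓞 k), ((p : ℕ) : 𝓞 k) ∈ v.asIdeal →
      ∀ w : V, (∀ d ∈ GreenbergSelmer.decomp v, d • w = w) → w = 0)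
    (n : ℕ)
    (f : Additive (ClassGroup (𝓞 (L₀ ⊔ κ.layer (n + 1) : IntermediateField k (AlgebraicClosure k))))
      →+ V)
    (hf : ∀ (τ : absoluteGaloisGroup k)
        (c : ClassGroup (𝓞 (L₀ ⊔ κ.layer (n + 1) : IntermediateField k (AlgebraicClosure k)))),
      f (Additive.ofMul (ClassGroup.mulEquiv (AmbiguousClass.intAut
        (absRestrictNormalHom (L₀ ⊔ κ.layer (n + 1) : IntermediateField k (AlgebraicClosure k)) τ))
          c)) = τ • f (Additive.ofMul c)) :
    f = 0 := by
  refine EquivariantIwasawaLemma.equivariantHom_classGroup_eq_zero_layer_compositum_tower_of_totallyRamified_of_splitAt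
    hp2 κ L₀ hL₀ hram hpV hV Sk ?_ h0 hD n f hf
  intro 𝔓 _ u hu h𝔓u x hx
  obtain ⟨q, hqu, hq⟩ := hSk u hu
  refine EquivariantIwasawaLemma.eq_zero_of_forall_stabilizer_smul_of_decomp
    (L₀ ⊔ κ.layer 1 : IntermediateField k (AlgebraicClosure k)) 𝔓 (p := q) ?_ hq x hx
  have h1 : algebraMap (𝓞 k) (𝓞 (L₀ ⊔ κ.layer 1 : IntermediateField k (AlgebraicClosure k)))
      ((q : ℕ) : 𝓞 k) ∈ 𝔓 := by
    rw [← Ideal.mem_comap, ← Ideal.under_def, h𝔓u]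
    exact hqu
  rwa [map_natCast] at h1

set_option maxHeartbeats 1600000 in
set_option synthInstance.maxHeartbeats 200000 in
/-- **Door L6 for an elliptic curve with the base hypothesis on the `S`-split class group.**  `E/ℚ`
elliptic (`W`), `p` an odd prime, `κ` the cyclotomic `ℤ_p`-extension of `ℚ`, `L_n = ℚ(E[p])ℚ_n =
W.divisionField p ⊔ κ.layer n`; `Sk` a set of finite places of `ℚ`, each containing a rational prime.
Assume (c1) `p ∤ #Gal(ℚ(E[p])/ℚ)`; (c2) every additive `Γ_ℚ`-equivariant `μ : Cl(𝓞_{ℚ(E[p])}) → E[p]` that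
kills the class of every prime of `ℚ(E[p])` above a place in `Sk` is zero (Deo–Ray–Sujatha's
`Hom_G(H′_L, E[p]) = 0` for `Sk ⊇` their `S`); (c3*) no non-zero `x ∈ E[p]` is fixed by the decomposition
group `D_v` for `v ∋ p` and for `v ∈ Sk`.  Then for every `n`, every additive `Γ_ℚ`-equivariant
`Cl(𝓞_{L_{n+1}}) → E[p]` is zero.  (`EquivariantIwasawaLemma.equivariantHom_classGroup_eq_zero_layer_
compositum_tower_of_totallyRamified_of_splitAt` at `k = ℚ`, `L₀ = ℚ(E[p])`, `V = E[p]`, `p` totally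
ramified in `ℚ_∞`; (c3*) at the primes of `L₁` above `Sk` from `D_v` by
`EquivariantIwasawaLemma.eq_zero_of_forall_stabilizer_smul_of_decomp`.)
[cite: Washington1997, §13.1 Prop. 13.2, §13.3 Lemmas 13.14–13.15 and Thm. 10.4 (proof)]
[cite: DeoRaySujatha2023, §3 Thm. 3.8 hypotheses (c1)–(c3) and the definition of H′_L (arXiv:2202.09937 p. 9)] -/
theorem homTrivial_divisionField_cyclotomicTower_of_splitAt
    (W : WeierstrassCurve ℚ) [W.IsElliptic] (p : ℕ) [Fact p.Prime] [NeZero p] (hp2 : p ≠ 2)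
    [NumberField (W.divisionField p)]
    (hG : ¬ p ∣ Nat.card ((W.divisionField p) ≃ₐ[ℚ] (W.divisionField p)))
    {κ : ZpExtension ℚ p} (hκ : κ.IsCyclotomic)
    (Sk : HeightOneSpectrum (𝓞 ℚ) → Prop)
    (hSk : ∀ u : HeightOneSpectrum (𝓞 ℚ), Sk u → ∃ q : ℕ, q.Prime ∧ ((q : ℕ) : 𝓞 ℚ) ∈ u.asIdeal)
    (hDS : ∀ u : HeightOneSpectrum (𝓞 ℚ), Sk u →
      ∀ x : geomTorsion W (p : ℤ), (∀ d ∈ GreenbergSelmer.decomp u, d • x = x) → x = 0)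
    (h0 : ∀ μ : Additive (ClassGroup (𝓞 (W.divisionField p))) →+ geomTorsion W (p : ℤ),
      (∀ (τ : absoluteGaloisGroup ℚ) (c : ClassGroup (𝓞 (W.divisionField p))),
        μ (Additive.ofMul (ClassGroup.mulEquiv
          (AmbiguousClass.intAut (absRestrictNormalHom (W.divisionField p) τ)) c)) =
          τ • μ (Additive.ofMul c)) →
      (∀ (v : HeightOneSpectrum (𝓞 (W.divisionField p))) (u : HeightOneSpectrum (𝓞 ℚ)), Sk u →
        v.asIdeal.under (𝓞 ℚ) = u.asIdeal →
        μ (Additive.ofMul (ClassGroup.mk0 ⟨v.asIdeal, mem_nonZeroDivisors_of_ne_zero v.ne_bot⟩)) = 0) →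
      μ = 0)
    (hD : ∀ v : HeightOneSpectrum (𝓞 ℚ), ((p : ℕ) : 𝓞 ℚ) ∈ v.asIdeal →
      ∀ x : geomTorsion W (p : ℤ), (∀ d ∈ GreenbergSelmer.decomp v, d • x = x) → x = 0)
    (n : ℕ) :
    haveI := κ.isGalois_layer_holds (n + 1)
    ∀ (f : Additive (ClassGroup (𝓞 ↥(W.divisionField p ⊔ κ.layer (n + 1)))) →+ geomTorsion W (p : ℤ)),
      (∀ (τ : absoluteGaloisGroup ℚ) (c : ClassGroup (𝓞 ↥(W.divisionField p ⊔ κ.layer (n + 1)))),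
        f (Additive.ofMul (ClassGroup.mulEquiv (AmbiguousClass.intAut
          (absRestrictNormalHom (W.divisionField p ⊔ κ.layer (n + 1)) τ)) c)) =
          τ • f (Additive.ofMul c)) →
      f = 0 := by
  haveI hgal := fun m => κ.isGalois_layer_holds m
  haveI hfd := fun m => κ.finiteDimensional_layer_holds m
  haveI hNF : ∀ m, NumberField ↥(W.divisionField p ⊔ κ.layer m) :=
    fun m => numberField_of_finiteDimensional' (W.divisionField p ⊔ κ.layer m)
  intro f hf
  have hL₀ := not_dvd_finrank_of_not_dvd_card' (W.divisionField p) hG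
  refine equivariantHom_classGroup_eq_zero_layer_compositum_tower_of_splitAt_of_decomp
    hp2 κ (W.divisionField p) hL₀
    (EquivariantIwasawaLemma.exists_isMaximal_inertia_sup_kerSubgroup_eq_top_of_isCyclotomic hκ)
    (geomTorsion_nsmul_eq_zero' W)
    (fun τ hτ v => (W.absRestrictNormalHom_divisionField_eq_one_iff p τ).mp hτ v) Sk ?_ h0 hD n f hf
  -- every `u ∈ Sk` contains a rational prime `q`, and `u` is the only place above `q`
  intro u hu
  obtain ⟨q, hq, hqu⟩ := hSk u hu
  refine ⟨q, hqu, fun v hv y hy => ?_⟩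
  have hvu : v = u := heightOneSpectrum_rat_eq_of_natCast_mem' hq v u hv hqu
  subst hvu
  exact hDS v hu y hy

/-- **Deo–Ray–Sujatha 2023, Thm. 3.9 (b) with Lemma 5.1, (c2) AS PRINTED — PROVED**: the named fact
`thm39_fineSelmerDual_moduleFinite_of_homTrivial_divisionField` holds.  `E/ℚ` elliptic, `p` odd, `E[p]`
irreducible (not used), (c1) `p ∤ #Gal(ℚ(E[p])/ℚ)`, (c2) `Hom_G(H′_{ℚ(E[p])}, E[p]) = 0` with `S =
{p} ∪ {bad}` (every `Γ_ℚ`-equivariant additive `Cl(𝓞_{ℚ(E[p])}) → E[p]` killing the classes of the primes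
above `S` is zero), (c3) at `p` and at the bad places (in the `E[p^∞]`-currency), `κ` cyclotomic ⟹ (A):
the dual fine Selmer group over `ℚ_∞` is finitely generated over `ℤ_p`.  Proof: door L6 with `S`-split
base (`homTrivial_divisionField_cyclotomicTower_of_splitAt`, layers `≥ 1`) and the `H²`-free isotypic
Coates–Sujatha argument (`CoatesSujatha2005.conjA_of_homTrivial_cyclotomicTower_succ`); the fact's
`galRestrict ℤ ℚ` phrasing of `τ·I` is the `intAut` phrasing (same underlying map,
`algebraMap_galRestrict_apply`), and its `E[p^∞]`-form of (c3) gives the `E[p]`-form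
(`geomTorsion_fixed_eq_zero_of_geomPrimaryTorsion`).
[cite: DeoRaySujatha2023, §3 Thm. 3.8, Thm. 3.9 (b), definition of H′_L (arXiv:2202.09937 pp. 9–10) and §5 Lemma 5.1 (p. 17)]
[cite: CoatesSujatha2005, §3 Thm. 3.4 (proof) and Lemma 3.8]
[cite: Washington1997, §13.3 Lemmas 13.14–13.15 and Thm. 10.4 (proof)] -/
theorem thm39_fineSelmerDual_moduleFinite_of_homTrivial_divisionField_holds :
    thm39_fineSelmerDual_moduleFinite_of_homTrivial_divisionField := by
  intro W _ p _ hp2 _ hG H hc3 κ hκ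
  have hp : p.Prime := Fact.out
  haveI : NeZero p := ⟨hp.ne_zero⟩
  haveI : NumberField (W.divisionField p) := NumberField.mk
  -- the set `S` of places of `ℚ`: those containing a prime `q` with `q = p` or bad reduction
  set Sk : HeightOneSpectrum (𝓞 ℚ) → Prop := fun u =>
    ∃ q : ℕ, q.Prime ∧ ((q : ℕ) : 𝓞 ℚ) ∈ u.asIdeal ∧ (q = p ∨ ¬ W.HasGoodReductionAt u) with hSkdef
  have hSk' : ∀ u : HeightOneSpectrum (𝓞 ℚ), Sk u →
      (((p : ℕ) : 𝓞 ℚ) ∈ u.asIdeal ∨ ¬ W.HasGoodReductionAt u) := by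
    rintro u ⟨q, hq, hqu, hS⟩
    rcases hS with h | h
    · subst h
      exact Or.inl hqu
    · exact Or.inr h
  refine CoatesSujatha2005.conjA_of_homTrivial_cyclotomicTower_succ W hp2 hκ fun n => ?_
  refine homTrivial_divisionField_cyclotomicTower_of_splitAt W p hp2 hG hκ Sk
    (fun u hu => ?_) (fun u hu x hx => ?_) (fun μ hμ hμS => ?_) (fun v hv x hx => ?_) n
  · obtain ⟨q, hq, hqu, -⟩ := hu
    exact ⟨q, hq, hqu⟩
  · exact geomTorsion_fixed_eq_zero_of_geomPrimaryTorsion W p u (hc3 u (hSk' u hu)) x hx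
  · -- (c2) printed ⟹ the `S`-split hypothesis of the tower
    refine H μ (fun τ I J hJ => ?_) (fun 𝔓 I q v hq hI hq𝔓 hqv hS => ?_)
    · -- the fact's `galRestrict ℤ ℚ` phrasing of `τ·I` is the `intAut` phrasing
      have hμ' := (EquivariantIwasawaLemma.equivariant_iff_forall_mk0
        (absRestrictNormalHom (W.divisionField p)) μ).mp hμ
      refine hμ' τ I J ?_
      have key : ∀ x : 𝓞 (W.divisionField p),
          galRestrict ℤ ℚ (W.divisionField p) (𝓞 (W.divisionField p))
              (absRestrictNormalHom (W.divisionField p) τ) x =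
            AmbiguousClass.intAut (absRestrictNormalHom (W.divisionField p) τ) x := by
        intro x
        refine RingOfIntegers.ext ?_
        exact algebraMap_galRestrict_apply ℤ _ x
      rw [hJ]
      simp only [Ideal.map]
      congr 1
      ext y
      simp only [Set.mem_image, SetLike.mem_coe, RingHom.coe_coe, key]
    · -- the class of a prime above `S`
      have hI' : I = ⟨𝔓.asIdeal, mem_nonZeroDivisors_of_ne_zero 𝔓.ne_bot⟩ := Subtype.ext hI
      rw [hI']
      refine hμS 𝔓 v ⟨q, hq, hqv, hS⟩ ?_
      -- `𝔓 ∩ ℚ = v`: both are the place of `q`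
      have hq0 : ((q : ℕ) : 𝓞 ℚ) ≠ 0 := by exact_mod_cast hq.ne_zero
      have hmem : ((q : ℕ) : 𝓞 ℚ) ∈ 𝔓.asIdeal.under (𝓞 ℚ) := by
        rw [Ideal.under_def, Ideal.mem_comap, map_natCast]
        exact hq𝔓
      haveI : (𝔓.asIdeal.under (𝓞 ℚ)).IsPrime := Ideal.IsPrime.under (𝓞 ℚ) 𝔓.asIdeal
      have hne : 𝔓.asIdeal.under (𝓞 ℚ) ≠ ⊥ := fun h => hq0 (by
        rw [h, Ideal.mem_bot] at hmem
        exact hmem)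
      have hw := heightOneSpectrum_rat_eq_of_natCast_mem' hq ⟨𝔓.asIdeal.under (𝓞 ℚ), inferInstance, hne⟩
        v hmem hqv
      exact congrArg HeightOneSpectrum.asIdeal hw
  · exact geomTorsion_fixed_eq_zero_of_geomPrimaryTorsion W p v (hc3 v (Or.inl hv)) x hx

end Literature.NumberTheory.EllipticCurves.DeoRaySujatha2023

end
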